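import Literature.Geometry.Riemannian.GradientShrinkerProofs
import Literature.Geometry.Lorentzian.RicciNormSq
import HarnessLib

/-!
# The Cheng–Ribeiro–Zhou sharp bound `∫(R − 2)² dV ≤ ½(e^{c}∫e^{-f} dV − Vol)` for `f ≤ c`
(stub `stub_crzSharpBound_of_identities` of line `cgy-variance-pivot`, crux
`EntropyRung.CompactShrinkerGap`, item stmt-SmoothPoincare4-10870)

For a Riemannian metric `g` (Levi-Civita connection) on a closed `4`-manifold, a smooth `f` with
`f ≤ c`, GIVEN the pointwise trace bound (T) `R² ≤ 4|Ric|²` and the integrated defect identity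
(I) `∫(R − 2)² dV = ∫(R − 2|Ric|²)(e^{c−f} − 1) dV` (both landed separately; here they are
hypotheses), the sharp bound of Cheng–Ribeiro–Zhou (§3.2, the printed
`Φ′(b) ≤ ½e^{b}∫Vol(D(t))e^{-t}dt`, and Remark 2) holds without any coarea formula:
`∫_M (R − 2)² dV_g ≤ ½ (e^{c} ∫_M e^{-f} dV_g − Vol_g(M))`.

Proof (real/measure bookkeeping only; every integrand is continuous on a compact manifold of finite
volume): pointwise, (T) gives `2|Ric|² ≥ R²/2`, so
`R − 2|Ric|² ≤ R − R²/2 = ½ − ½(R − 1)² ≤ ½`, while `f ≤ c` gives the non-negative weight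
`e^{c−f} − 1 ≥ 0`; hence `(R − 2|Ric|²)(e^{c−f} − 1) ≤ ½(e^{c−f} − 1)`. Integrating
(`integral_mono`) and computing `∫ ½(e^{c−f} − 1) dV = ½(e^{c}∫e^{-f} dV − Vol)`
(`e^{c−f} = e^{c}e^{-f}`), (I) finishes. Equality at the round shrinker `S⁴(√6)`, `f ≡ 2`,
`c = 2`: both sides `0`.
Everything is proved; no definition, no named fact.

References: X. Cheng, E. Ribeiro Jr, D. Zhou, arXiv:2203.14916, §3.2 and Remark 2
[ChengRibeiroZhou2022].
-/

noncomputable section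

-- the registered namespace `Summit.SmoothPoincare4.SmoothPoincare4.Theorems` repeats a component
set_option linter.dupNamespace false

open Bundle Set Function Filter Module MeasureTheory
open scoped Manifold ContDiff Topology

namespace Summit.SmoothPoincare4.SmoothPoincare4.Theorems

open Literature.Geometry Literature.Geometry.Lorentzian Literature.Geometry.Riemannian
  Literature.Geometry.Lorentzian.PseudoRiemannianMetric

/-- **STUB `stub_crzSharpBound_of_identities` of line `cgy-variance-pivot` — the Cheng–Ribeiro–Zhou
sharp bound `∫(R − 2)² dV ≤ ½(e^{c}∫e^{-f} dV − Vol)` for `f ≤ c`, from the trace bound and the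
defect identity as hypotheses.** On a CLOSED 4-manifold with Riemannian `g` (Levi-Civita), smooth
`f ≤ c`, GIVEN `R² ≤ 4|Ric|²` pointwise and `∫(R − 2)² = ∫(R − 2|Ric|²)(e^{c−f} − 1)`:
pointwise `R − 2|Ric|² ≤ R − R²/2 = ½(1 − (R − 1)²) ≤ ½` and `e^{c−f} − 1 ≥ 0`, so
`∫(R − 2)² ≤ ½∫(e^{c−f} − 1) = ½(e^{c}∫e^{-f} − Vol)` (integrands continuous on the compact `M`:
`contMDiff_scalarCurvature`, `contMDiff_normSq_ricci'`; `riemVolume_eq`, `integral_mono`).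
Equality at the round shrinker with `c = 2`. This is the printed bound of CRZ §3.2
(`Φ′(b) ≤ ½e^{b}∫Vol(D(t))e^{-t}dt`) without the coarea formula.
[cite: ChengRibeiroZhou2022, §3.2 and Rem. 2] -/
theorem stub_crzSharpBound_of_identities :
    ∀ (M : Type) [TopologicalSpace M] [T2Space M] [SecondCountableTopology M]
      [ChartedSpace (EuclideanSpace ℝ (Fin 4)) M] [IsManifold (𝓡 4) ∞ M] [CompactSpace M]
      [T3Space M] [MeasurableSpace M] [BorelSpace M]
      (g : Literature.Geometry.Lorentzian.PseudoRiemannianMetric (𝓡 4) ∞ (EuclideanSpace ℝ (Fin 4))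
        (TangentSpace (𝓡 4) : M → Type _)) [g.HasLeviCivita] (f : M → ℝ) (hg : g.IsRiemannian),
      ContMDiff (𝓡 4) 𝓘(ℝ, ℝ) ∞ f →
      (∀ x : M, g.scalarCurvature x ^ 2 ≤ 4 * g.normSq x (g.ricci x)) →
      ∀ c : ℝ, (∀ x : M, f x ≤ c) →
      ∫ x, (g.scalarCurvature x - 2) ^ 2
          ∂(Literature.Geometry.Lorentzian.riemannianMeasure (g.toContMDiffRiemannianMetric hg)) =
        ∫ x, (g.scalarCurvature x - 2 * g.normSq x (g.ricci x)) * (Real.exp (c - f x) - 1)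
          ∂(Literature.Geometry.Lorentzian.riemannianMeasure (g.toContMDiffRiemannianMetric hg)) →
      ∫ x, (g.scalarCurvature x - 2) ^ 2
          ∂(Literature.Geometry.Lorentzian.riemannianMeasure (g.toContMDiffRiemannianMetric hg)) ≤
        1 / 2 * (Real.exp c *
            ∫ x, Real.exp (-f x)
              ∂(Literature.Geometry.Lorentzian.riemannianMeasure (g.toContMDiffRiemannianMetric hg)) -
          ((Literature.Geometry.Lorentzian.riemannianMeasure (g.toContMDiffRiemannianMetric hg))
            Set.univ).toReal) := by
  intro M _ _ _ _ _ _ _ _ _ g _ f hg hf hT c hfc hI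
  -- the Riemannian measure is `g.riemVolume`, a finite measure
  have hV : g.riemVolume = riemannianMeasure (g.toContMDiffRiemannianMetric hg) :=
    PseudoRiemannianMetric.riemVolume_eq hg
  haveI : IsFiniteMeasure g.riemVolume := ⟨g.riemVolume_univ_lt_top⟩
  rw [← hV] at hI ⊢
  -- continuity, hence integrability, of every integrand
  have hRc : Continuous g.scalarCurvature := g.contMDiff_scalarCurvature.continuous
  have hQc : Continuous fun x ↦ g.normSq x (g.ricci x) := g.contMDiff_normSq_ricci'.continuous
  have hec : Continuous fun x ↦ Real.exp (-f x) := Real.continuous_exp.comp hf.continuous.neg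
  have hwc : Continuous fun x ↦ Real.exp (c - f x) - 1 :=
    (Real.continuous_exp.comp (continuous_const.sub hf.continuous)).sub continuous_const
  have iL : Integrable (fun x ↦ (g.scalarCurvature x - 2 * g.normSq x (g.ricci x)) *
      (Real.exp (c - f x) - 1)) g.riemVolume :=
    g.integrable_of_continuous ((hRc.sub (continuous_const.mul hQc)).mul hwc)
  have iw : Integrable (fun x ↦ 1 / 2 * (Real.exp (c - f x) - 1)) g.riemVolume :=
    g.integrable_of_continuous (continuous_const.mul hwc)
  have ie : Integrable (fun x ↦ Real.exp (-f x)) g.riemVolume := g.integrable_of_continuous hec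
  have iec : Integrable (fun x ↦ Real.exp c * Real.exp (-f x)) g.riemVolume := ie.const_mul _
  -- pointwise: `R − 2|Ric|² ≤ ½` (trace bound) against the non-negative weight `e^{c−f} − 1`
  have hpt : ∀ x, (g.scalarCurvature x - 2 * g.normSq x (g.ricci x)) * (Real.exp (c - f x) - 1) ≤
      1 / 2 * (Real.exp (c - f x) - 1) := fun x ↦ by
    have h1 : g.scalarCurvature x - 2 * g.normSq x (g.ricci x) ≤ 1 / 2 := by
      nlinarith [hT x, sq_nonneg (g.scalarCurvature x - 1)]
    have h2 : 0 ≤ Real.exp (c - f x) - 1 := by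
      linarith [Real.add_one_le_exp (c - f x), hfc x]
    exact mul_le_mul_of_nonneg_right h1 h2
  have hle := integral_mono iL iw hpt
  -- `∫ ½(e^{c−f} − 1) dV = ½(e^{c}∫e^{-f} dV − Vol)`
  have e1 : ∫ x, 1 / 2 * (Real.exp (c - f x) - 1) ∂g.riemVolume =
      1 / 2 * (Real.exp c * ∫ x, Real.exp (-f x) ∂g.riemVolume - (g.riemVolume univ).toReal) := by
    have hexp : ∀ x, Real.exp (c - f x) = Real.exp c * Real.exp (-f x) := fun x ↦ by
      rw [sub_eq_add_neg, Real.exp_add]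
    simp_rw [hexp]
    rw [integral_const_mul, integral_sub iec (integrable_const _), integral_const_mul,
      integral_const, smul_eq_mul, Measure.real, mul_one]
  rw [hI]
  linarith [hle, e1]

end Summit.SmoothPoincare4.SmoothPoincare4.Theorems

end
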